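import Literature.Probability.RandomPlanarGeometry.SAWLoopErasureKestenRenewal
import HarnessLib

/-!
# The renewal floor to second order: `μ(ℤ^d) ≥ 2d − 1 − 1/(2d) − 1/d² − O(d⁻³)`, via the exact `p₄(0)`

Topic `Literature/Probability/RandomPlanarGeometry`; a leaf over `SAWLoopErasureKestenRenewal.lean` (by name:
`two_mul_div_renewal_le_connectiveConstant_of_le : G_d ≤ B → 2d/(2 − 1/B) ≤ μ(ℤ^d)`, `d ≥ 3`) and its parent
`SAWLoopErasureKesten.lean` (`srwI_one_zero_zero_le_explicit₇`, `srwLaw_succ_zero_eq_stepVec`); the simple-random-walk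
law `srwLaw d n x = pₙ(x)` is the lace build's (`Literature.Barriers.CriticalPhenomena.LongRangePhi4.srwLaw`, recursion
`srwLaw_succ_apply`), its Green function `srwI d 1 0 0 = G_d = C₀(0,0;1/(2d))` and Taylor enclosure
`abs_srwI_sub_taylor_le_kernel` are Fitzner–van der Hofstad's (`Literature/Probability/FitznerVanDerHofstad2017`).

SOURCES AS PRINTED. Hara–Slade–Sokal, *New lower bounds on the self-avoiding-walk connective constant*, J. Stat.
Phys. 72 (1993) 479–517 = arXiv:hep-lat/9302003 (held text `paper:arxiv-hep-lat_9302003`; page numbers are the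
arXiv pages). §6.3 "1/d expansion for the loop-erasure-and-restoration lower bounds" (p. 27), with `s = 1/(2d)`:
eq. (6.18) "The standard of comparison for all our bounds is the series `μ = s⁻¹ − 1 − s − 3s² − 16s³ − 102s⁴ − …`
which is provably correct through order `s³`"; eq. (6.20) "The next simplest bound (2.32) is based on τ = 0, k = 1;
using (A.17) and (2.33), we obtain `μ^{(0,1)} = 2d / C^{{e}}(0,0;1/(2d)) = s⁻¹ − 1 − s − 4s² − 22s³ − 143s⁴ + O(s⁵)`.
This gets the first three terms correct, and just barely misses the term of order `s²`." Appendix A (p. 33):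
"In particular for `C₀(0,x;1/(2d)) = I₁,₀(x)` we have `I₁₀(0) = 1 + s + 3s² + 12s³ + 60s⁴ + 355s⁵ + O(s⁶)`,
`I₁₀(e₁) = s + 3s² + 12s³ + …`, `I₁₀(2e₁) = s² + 6s³ + 37s⁴ + …`, `I₁₀(e₁ + e₂) = 2s² + 12s³ + 66s⁴ + …`".

WHAT IS HERE (all `d`; standard axioms).
* Exact small-time values of the step distribution, from the recursion `p_{n+1}(x) = (2d)⁻¹Σ_j (pₙ(x+e_j) + pₙ(x−e_j))`
  split at one axis: `srwLaw_one_single : p₁(e_k) = s`, `srwLaw_two_zero : p₂(0) = s`,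
  `srwLaw_two_single_two : p₂(2e_k) = s²`, `srwLaw_two_corner : p₂(e_j ± e_k) = 2s²` (`j ≠ k`),
  `srwLaw_three_single : p₃(e_k) = (6d − 3)/(2d)³`, and **`srwLaw_four_zero : p₄(0) = 3/(4d²) − 3/(8d³)`**
  (`= 3s² − 3s³ = u₄/(2d)⁴`, `u₄ = 12d² − 6d` closed four-step walks) — the leading terms of the four printed
  `I₁₀` expansions above. The tree previously used only the Gaussian bound `p₄(0) ≤ 3/(4d²)` (`srwLaw_two_mul_zero_le`).
* Green-function enclosures (`d ≥ 5`): `srwI_one_zero_zero_le_sharp₇ : G_d ≤ 1 + 1/(2d) + 3/(4d²) + 3/(2d³) + 11392/d⁴`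
  (the parent's seven-term enclosure with the exact `p₄`, `d⁻³` coefficient `15/8 → 3/2`) and the nine-term
  `srwI_one_zero_zero_le_sharp₉ : G_d ≤ 1 + 1/(2d) + 3/(4d²) + 3/(2d³) + 105/(16d⁴) + 102352/d⁵`
  (`R = 9`, remainder `2⁷√(19‼)/(2d)⁵ ≤ 102352/d⁵`; sharper for `d ≥ 10`).
* **HEADLINES** (`d ≥ 5`, by the monotone renewal form of the landed (0,1) bound):
  `kesten_second_order_renewal_sharp₇ : 2d − 1 − 1/(2d) − 1/d² − 22784/d³ ≤ μ(ℤ^d)` and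
  `kesten_second_order_renewal_sharp₉ : 2d − 1 − 1/(2d) − 1/d² − 9/d³ − 204704/d⁴ ≤ μ(ℤ^d)`, i.e.
  `μ ≥ s⁻¹ − 1 − s − 4s² − O(s³)`: the printed `s²` coefficient of (6.20) as a rigorous inequality at every `d ≥ 5`
  (the tree's previous value was `−7s²`, `kesten_second_order_effective_renewal`; the truth is `−3s²`, (6.18)).

HONEST SCOPE (numbers, not adjectives). The gain is asymptotic: both closed forms are negative for `d ≤ 10` and below the tree's kernel floors
for small `d`; they exceed the previous closed-form floor
`2d − 1 − 1/(2d) − 7/(4d²) − 22778/d³` from `d = 11` on (`d = 12`: 13.07 (R = 9) / 9.77 (R = 7) vs 9.76; `d = 20`: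
37.69 / 36.12 vs 36.12; `d = 100`: 198.99284 / 198.97213 vs 198.97203, against `μ(ℤ¹⁰⁰) = 198.99492…` from (6.18)).
The `d⁻³` constants are crude (`22784 = 2·11392` is twice the `R = 7` Taylor remainder constant); the exact (0,1)
bound has `−22s³`. Printed status: the expansions (6.18)/(6.20)/(A.17) are PRINTED (asymptotic series and, for
`d ≤ 6`, numerical values from exact Green functions); the all-`d` inequality with explicit constants and the
kernel-exact `p₄(0)` on the lace build's `srwLaw` are this file's (LANE corollary / CONSOLIDATION of (6.20) at order `s²`).

## References
- [HSS93] T. Hara, G. Slade, A. D. Sokal, New lower bounds on the self-avoiding-walk connective constant,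
  J. Stat. Phys. 72 (1993) 479–517, arXiv:hep-lat/9302003 — §2.3 (2.32)–(2.33), §6.3 (6.18)–(6.20), Appendix A.
- [FvdH17] R. Fitzner, R. van der Hofstad, Mean-field behavior for nearest-neighbor percolation in d > 10 (and the
  NoBLE Taylor remainder, (5.1)) — the `srwI` enclosure machinery used by name.
-/

noncomputable section

open Finset
open scoped BigOperators Nat

namespace Literature.Probability.RandomPlanarGeometry.SAW.Zd.LoopErasure

open Literature.Probability.LatticeModels Literature.Probability.LatticeModels.SRW
open Literature.Barriers.CriticalPhenomena Literature.Barriers.CriticalPhenomena.LongRangePhi4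
open Literature.Probability.FitznerVanDerHofstad2017

variable {d : ℕ}

/-! ### Exact small-time values of the simple-random-walk law -/

/-- `p₁(z) = 0` as soon as `‖z‖₁ ≥ 2` (one step reaches only the unit vectors). [cite: HaraSladeSokal1993, Appendix A, (A.17) (arXiv p. 33); lane plumbing] -/
theorem srwLaw_one_eq_zero_of_two_le (z : Site d) (hz : 2 ≤ ∑ i, (z i).natAbs) : srwLaw d 1 z = 0 := by
  rw [srwLaw_succ_apply]
  have hδ : ∀ (j : Fin d) (τ : ℤ), τ = 1 ∨ τ = -1 → srwLaw d 0 (z + Pi.single j τ) = 0 := by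
    intro j τ hτ
    rw [srwLaw_zero_apply, if_neg]
    intro h
    have hz' : z = (Pi.single j (-τ) : Site d) := by
      rw [Pi.single_neg]
      exact add_eq_zero_iff_eq_neg.1 h
    have hone : ∑ i, ((Pi.single j (-τ) : Site d) i).natAbs = 1 := by
      rw [Finset.sum_eq_single j (fun i _ hij => by simp [hij]) (fun h => absurd (Finset.mem_univ j) h)]
      rcases hτ with rfl | rfl <;> simp
    rw [hz', hone] at hz
    omega
  have hterm : ∀ j : Fin d, srwLaw d 0 (z + Pi.single j 1) + srwLaw d 0 (z - Pi.single j 1) = 0 := by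
    intro j
    rw [sub_eq_add_neg, ← Pi.single_neg, hδ j 1 (Or.inl rfl), hδ j (-1) (Or.inr rfl), add_zero]
  rw [Finset.sum_congr rfl (fun j _ => hterm j), Finset.sum_const_zero, zero_div]

/-- `‖v‖₁ ≥ 2` if one coordinate has absolute value at least two. [cite: HaraSladeSokal1993, Appendix A, (A.17) (arXiv p. 33); lane plumbing] -/
theorem two_le_sum_natAbs_of_coord (v : Site d) (a : Fin d) (ha : 2 ≤ (v a).natAbs) :
    2 ≤ ∑ i, (v i).natAbs :=
  le_trans ha (Finset.single_le_sum (f := fun i => (v i).natAbs) (fun _ _ => Nat.zero_le _) (Finset.mem_univ a))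

/-- `‖v‖₁ ≥ 2` if two different coordinates are non-zero. [cite: HaraSladeSokal1993, Appendix A, (A.17) (arXiv p. 33); lane plumbing] -/
theorem two_le_sum_natAbs_of_two_coords (v : Site d) {a b : Fin d} (hab : a ≠ b) (ha : v a ≠ 0)
    (hb : v b ≠ 0) : 2 ≤ ∑ i, (v i).natAbs := by
  have h1 : 1 ≤ (v a).natAbs := Int.natAbs_pos.2 ha
  have h2 : 1 ≤ (v b).natAbs := Int.natAbs_pos.2 hb
  have hsub : ∑ i ∈ ({a, b} : Finset (Fin d)), (v i).natAbs ≤ ∑ i, (v i).natAbs :=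
    Finset.sum_le_sum_of_subset_of_nonneg (Finset.subset_univ _) (fun _ _ _ => Nat.zero_le _)
  rw [Finset.sum_pair hab] at hsub
  omega

/-- **`p₁(e_k) = 1/(2d)`.** [cite: HaraSladeSokal1993, Appendix A, (A.17) (arXiv p. 33); lane plumbing] -/
theorem srwLaw_one_single (k : Fin d) : srwLaw d 1 (Pi.single k 1 : Site d) = 1 / (2 * (d : ℝ)) := by
  rw [srwLaw_succ_apply]
  have hterm : ∀ j : Fin d, srwLaw d 0 ((Pi.single k 1 : Site d) + Pi.single j 1) +
      srwLaw d 0 ((Pi.single k 1 : Site d) - Pi.single j 1) = if j = k then 1 else 0 := by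
    intro j
    rw [srwLaw_zero_apply, srwLaw_zero_apply]
    have h1 : ((Pi.single k 1 : Site d) + Pi.single j 1) ≠ 0 := by
      intro h
      have := congrFun h k
      simp only [Pi.add_apply, Pi.single_eq_same, Pi.single_apply, Pi.zero_apply] at this
      split_ifs at this <;> omega
    by_cases hjk : j = k
    · subst hjk
      rw [if_neg h1, sub_self, if_pos rfl, if_pos rfl, zero_add]
    · have h2 : ((Pi.single k 1 : Site d) - Pi.single j 1) ≠ 0 := by
        intro h
        have := congrFun h k
        simp only [Pi.sub_apply, Pi.single_eq_same, Pi.single_apply, Pi.zero_apply, if_neg (Ne.symm hjk)]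
          at this
        omega
      rw [if_neg h1, if_neg h2, if_neg hjk, zero_add]
  rw [Finset.sum_congr rfl (fun j _ => hterm j), Finset.sum_ite_eq' Finset.univ k (fun _ => (1 : ℝ)),
    if_pos (Finset.mem_univ _)]

/-- `p₁(σ e_k) = 1/(2d)` for `σ = ±1`. [cite: HaraSladeSokal1993, Appendix A, (A.17) (arXiv p. 33); lane plumbing] -/
theorem srwLaw_one_single_sign (k : Fin d) {σ : ℤ} (hσ : σ = 1 ∨ σ = -1) :
    srwLaw d 1 (Pi.single k σ : Site d) = 1 / (2 * (d : ℝ)) := by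
  rcases hσ with rfl | rfl
  · exact srwLaw_one_single k
  · rw [Pi.single_neg, srwLaw_neg k.pos]
    exact srwLaw_one_single k

/-- **`p₂(0) = 1/(2d)`** (`d ≥ 1`). [cite: HaraSladeSokal1993, Appendix A, (A.17) (arXiv p. 33); lane plumbing] -/
theorem srwLaw_two_zero (hd : 1 ≤ d) : srwLaw d 2 (0 : Site d) = 1 / (2 * (d : ℝ)) := by
  rw [srwLaw_succ_zero_eq_stepVec hd 1 (((⟨0, hd⟩ : Fin d), true) : Dir d),
    show stepVec (((⟨0, hd⟩ : Fin d), true) : Dir d) = (Pi.single (⟨0, hd⟩ : Fin d) 1 : Site d) by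
      simp [stepVec]]
  exact srwLaw_one_single _

/-- **`p₂(2e_k) = 1/(2d)²`.** [cite: HaraSladeSokal1993, Appendix A, (A.17) (arXiv p. 33); lane plumbing] -/
theorem srwLaw_two_single_two (k : Fin d) :
    srwLaw d 2 (Pi.single k 2 : Site d) = 1 / (2 * (d : ℝ)) ^ 2 := by
  rw [srwLaw_succ_apply]
  have hterm : ∀ j : Fin d, srwLaw d 1 ((Pi.single k 2 : Site d) + Pi.single j 1) +
      srwLaw d 1 ((Pi.single k 2 : Site d) - Pi.single j 1) = if j = k then 1 / (2 * (d : ℝ)) else 0 := by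
    intro j
    have hA : srwLaw d 1 ((Pi.single k 2 : Site d) + Pi.single j 1) = 0 := by
      refine srwLaw_one_eq_zero_of_two_le _ (two_le_sum_natAbs_of_coord _ k ?_)
      simp only [Pi.add_apply, Pi.single_eq_same, Pi.single_apply]
      split_ifs <;> decide
    by_cases hjk : j = k
    · subst hjk
      have hB : ((Pi.single j 2 : Site d) - Pi.single j 1) = Pi.single j 1 := by
        rw [← Pi.single_sub]; norm_num
      rw [hA, hB, srwLaw_one_single, if_pos rfl, zero_add]
    · have hB : srwLaw d 1 ((Pi.single k 2 : Site d) - Pi.single j 1) = 0 := by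
        refine srwLaw_one_eq_zero_of_two_le _ (two_le_sum_natAbs_of_coord _ k ?_)
        simp only [Pi.sub_apply, Pi.single_eq_same, Pi.single_apply, if_neg (Ne.symm hjk)]
        decide
      rw [hA, hB, if_neg hjk, zero_add]
  rw [Finset.sum_congr rfl (fun j _ => hterm j), Finset.sum_ite_eq' Finset.univ k, if_pos (Finset.mem_univ _)]
  ring

/-- **`p₂(e_j + σe_k) = 2/(2d)²`** for `j ≠ k`, `σ = ±1`. [cite: HaraSladeSokal1993, Appendix A, (A.17) (arXiv p. 33); lane plumbing] -/
theorem srwLaw_two_corner {j k : Fin d} (hjk : j ≠ k) {σ : ℤ} (hσ : σ = 1 ∨ σ = -1) :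
    srwLaw d 2 ((Pi.single j 1 : Site d) + Pi.single k σ) = 2 / (2 * (d : ℝ)) ^ 2 := by
  rw [srwLaw_succ_apply]
  have hσ0 : σ ≠ 0 := by rcases hσ with rfl | rfl <;> decide
  set y : Site d := (Pi.single j 1 : Site d) + Pi.single k σ with hy
  -- coordinates of `y ± e_i`
  have hyj : y j = 1 := by simp [hy, hjk]
  have hyk : y k = σ := by simp [hy, Ne.symm hjk]
  have hvan : ∀ (i : Fin d) (τ : ℤ), i ≠ j → i ≠ k → srwLaw d 1 (y + Pi.single i τ) = 0 := by
    intro i τ hij hik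
    refine srwLaw_one_eq_zero_of_two_le _ (two_le_sum_natAbs_of_two_coords _ hjk ?_ ?_)
    · simp [Ne.symm hij, hyj]
    · simp [Ne.symm hik, hyk, hσ0]
  have hterm : ∀ i : Fin d, srwLaw d 1 (y + Pi.single i 1) + srwLaw d 1 (y - Pi.single i 1) =
      (if i = j then 1 / (2 * (d : ℝ)) else 0) + (if i = k then 1 / (2 * (d : ℝ)) else 0) := by
    intro i
    by_cases hij : i = j
    · subst hij
      rw [if_pos rfl, if_neg hjk, add_zero]
      have hA : srwLaw d 1 (y + Pi.single i 1) = 0 := by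
        refine srwLaw_one_eq_zero_of_two_le _ (two_le_sum_natAbs_of_coord _ i ?_)
        simp [hyj]
      have hB : y - Pi.single i 1 = Pi.single k σ := by rw [hy]; abel
      rw [hA, hB, srwLaw_one_single_sign k hσ, zero_add]
    by_cases hik : i = k
    · subst hik
      rw [if_neg hij, if_pos rfl, zero_add]
      rcases hσ with rfl | rfl
      · have hA : srwLaw d 1 (y + Pi.single i 1) = 0 := by
          refine srwLaw_one_eq_zero_of_two_le _ (two_le_sum_natAbs_of_coord _ i ?_)
          simp [hyk]
        have hB : y - Pi.single i 1 = Pi.single j 1 := by rw [hy]; abel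
        rw [hA, hB, srwLaw_one_single, zero_add]
      · have hA : y + Pi.single i 1 = Pi.single j 1 := by
          rw [hy, Pi.single_neg]; abel
        have hB : srwLaw d 1 (y - Pi.single i 1) = 0 := by
          refine srwLaw_one_eq_zero_of_two_le _ (two_le_sum_natAbs_of_coord _ i ?_)
          simp [hyk]
        rw [hA, hB, srwLaw_one_single, add_zero]
    · rw [if_neg hij, if_neg hik, add_zero, sub_eq_add_neg, ← Pi.single_neg, hvan i 1 hij hik,
        hvan i (-1) hij hik, add_zero]
  rw [Finset.sum_congr rfl (fun i _ => hterm i), Finset.sum_add_distrib, Finset.sum_ite_eq' Finset.univ j,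
    Finset.sum_ite_eq' Finset.univ k, if_pos (Finset.mem_univ _), if_pos (Finset.mem_univ _)]
  ring

/-- **`p₃(e_k) = (6d − 3)/(2d)³`** (`= 3s² − 3s³`, `s = 1/(2d)`). [cite: HaraSladeSokal1993, Appendix A, (A.17) (arXiv p. 33); lane plumbing] -/
theorem srwLaw_three_single (k : Fin d) :
    srwLaw d 3 (Pi.single k 1 : Site d) = (6 * (d : ℝ) - 3) / (2 * (d : ℝ)) ^ 3 := by
  have hd : 1 ≤ d := k.pos
  have hd0 : (d : ℝ) ≠ 0 := by exact_mod_cast (show d ≠ 0 by omega)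
  rw [srwLaw_succ_apply]
  have hterm : ∀ i : Fin d, srwLaw d 2 ((Pi.single k 1 : Site d) + Pi.single i 1) +
      srwLaw d 2 ((Pi.single k 1 : Site d) - Pi.single i 1) =
      4 / (2 * (d : ℝ)) ^ 2 + (if i = k then 1 / (2 * (d : ℝ)) ^ 2 + 1 / (2 * (d : ℝ)) - 4 / (2 * (d : ℝ)) ^ 2
        else 0) := by
    intro i
    by_cases hik : i = k
    · subst hik
      rw [← Pi.single_add, sub_self, one_add_one_eq_two, srwLaw_two_single_two, srwLaw_two_zero hd, if_pos rfl]
      ring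
    · rw [if_neg hik, add_zero, sub_eq_add_neg, ← Pi.single_neg, srwLaw_two_corner (Ne.symm hik) (Or.inl rfl),
        srwLaw_two_corner (Ne.symm hik) (Or.inr rfl)]
      ring
  rw [Finset.sum_congr rfl (fun i _ => hterm i), Finset.sum_add_distrib, Finset.sum_const, Finset.card_univ,
    Fintype.card_fin, Finset.sum_ite_eq' Finset.univ k, if_pos (Finset.mem_univ _), nsmul_eq_mul]
  field_simp
  ring

/-- **`p₄(0) = 3/(4d²) − 3/(8d³)`** (`d ≥ 1`): the exact four-step return probability of simple random walk on
`ℤ^d` (`= u₄/(2d)⁴`, `u₄ = 12d² − 6d` closed four-step walks; `3s² − 3s³` with `s = 1/(2d)`). [cite: HaraSladeSokal1993, Appendix A, (A.17) (arXiv p. 33); lane plumbing] -/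
theorem srwLaw_four_zero (hd : 1 ≤ d) :
    srwLaw d 4 (0 : Site d) = 3 / (4 * (d : ℝ) ^ 2) - 3 / (8 * (d : ℝ) ^ 3) := by
  have hd0 : (d : ℝ) ≠ 0 := by exact_mod_cast (show d ≠ 0 by omega)
  rw [srwLaw_succ_zero_eq_stepVec hd 3 (((⟨0, hd⟩ : Fin d), true) : Dir d),
    show stepVec (((⟨0, hd⟩ : Fin d), true) : Dir d) = (Pi.single (⟨0, hd⟩ : Fin d) 1 : Site d) by
      simp [stepVec], srwLaw_three_single]
  field_simp
  ring


/-! ### The Green function at the origin with the exact `p₄(0)` -/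

/-- **`G_d ≤ 1 + 1/(2d) + 3/(4d²) + 3/(2d³) + 11392/d⁴`** for `d ≥ 5`: the parent's seven-term enclosure
`srwI_one_zero_zero_le_explicit₇` with the Gaussian bound `p₄(0) ≤ 3/(4d²)` replaced by the exact value
`p₄(0) = 3/(4d²) − 3/(8d³)` (`srwLaw_four_zero`), which lowers the `d⁻³` coefficient from `15/8` to `3/2`.
[cite: HaraSladeSokal1993, Appendix A, eq. (A.17) (I₁,₀(0) = 1 + s + 3s² + 12s³ + …, s = 1/(2d))] -/
theorem srwI_one_zero_zero_le_sharp₇ (hd : 5 ≤ d) :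
    srwI d 1 0 0 ≤ 1 + 1 / (2 * (d : ℝ)) + 3 / (4 * (d : ℝ) ^ 2) + 3 / (2 * (d : ℝ) ^ 3) + 11392 / (d : ℝ) ^ 4 := by
  have hd1 : 1 ≤ d := by omega
  have hd0 : (0 : ℝ) < d := by exact_mod_cast (show 0 < d by omega)
  have h := abs_srwI_sub_taylor_le_kernel (d := d) (n := 0) (l := 0) (R := 7) (by omega)
    (by decide) (0 : Fin d → ℤ)
  have hp0 : srwLaw d 0 (0 : Fin d → ℤ) = 1 := by rw [srwLaw_zero_apply, if_pos rfl]
  have hp1 : srwLaw d 1 (0 : Fin d → ℤ) = 0 := by simpa using srwLaw_odd_zero (d := d) 0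
  have hp3 : srwLaw d 3 (0 : Fin d → ℤ) = 0 := by simpa using srwLaw_odd_zero (d := d) 1
  have hp5 : srwLaw d 5 (0 : Fin d → ℤ) = 0 := by simpa using srwLaw_odd_zero (d := d) 2
  have hp7 : srwLaw d 7 (0 : Fin d → ℤ) = 0 := by simpa using srwLaw_odd_zero (d := d) 3
  have hp2 : srwLaw d 2 (0 : Fin d → ℤ) = 1 / (2 * (d : ℝ)) := srwLaw_two_zero hd1
  have hp4 : srwLaw d 4 (0 : Fin d → ℤ) = 3 / (4 * (d : ℝ) ^ 2) - 3 / (8 * (d : ℝ) ^ 3) := srwLaw_four_zero hd1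
  have hp6 : srwLaw d 6 (0 : Fin d → ℤ) ≤ 15 / (8 * (d : ℝ) ^ 3) := by
    have := srwLaw_two_mul_zero_le hd1 3
    norm_num [Nat.doubleFactorial] at this
    have e : (2 * (d : ℝ)) ^ 3 = 8 * (d : ℝ) ^ 3 := by ring
    rw [e] at this
    exact this
  have hsum : ∑ i ∈ range (7 + 1), (((i + 0).choose 0 : ℕ) : ℝ) * srwLaw d (0 + i) 0 =
      1 + srwLaw d 2 0 + srwLaw d 4 0 + srwLaw d 6 0 := by
    simp only [Finset.sum_range_succ, Finset.sum_range_zero, Nat.add_zero, Nat.choose_zero_right, Nat.cast_one,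
      one_mul, Nat.zero_add, hp0, hp1, hp3, hp5, hp7]
    ring
  have hrem : ∑ t ∈ range (0 + 1), (((7 + t).choose t : ℕ) : ℝ) *
      (Real.sqrt ((((2 * (0 + 7 + 1) - 1)‼ : ℕ) : ℝ) / (2 * (d : ℝ)) ^ (0 + 7 + 1)) *
        (2 : ℝ) ^ (6 * (0 + 1 - t) + 1)) ≤ 11392 / (d : ℝ) ^ 4 := by
    have h15 : (((2 * (0 + 7 + 1) - 1)‼ : ℕ) : ℝ) = 2027025 := by norm_num [Nat.doubleFactorial]
    simp only [Finset.sum_range_succ, Finset.sum_range_zero, zero_add, Nat.add_zero, Nat.choose_zero_right,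
      Nat.cast_one, one_mul, h15]
    norm_num
    have hs8 : Real.sqrt ((2 * (d : ℝ)) ^ 8) = (2 * (d : ℝ)) ^ 4 := by
      rw [show (2 * (d : ℝ)) ^ 8 = ((2 * (d : ℝ)) ^ 4) ^ 2 by ring, Real.sqrt_sq (by positivity)]
    have hs1 : Real.sqrt 2027025 ≤ 1424 := by
      rw [show (1424 : ℝ) = Real.sqrt (1424 ^ 2) by rw [Real.sqrt_sq (by norm_num)]]
      exact Real.sqrt_le_sqrt (by norm_num)
    have hs0 : 0 ≤ Real.sqrt 2027025 := Real.sqrt_nonneg _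
    rw [hs8, div_mul_eq_mul_div, div_le_div_iff₀ (by positivity) (by positivity)]
    have hd4 : (0 : ℝ) < (d : ℝ) ^ 4 := by positivity
    nlinarith [mul_le_mul_of_nonneg_right hs1 hd4.le]
  have hmain := (abs_sub_le_iff.1 h).1
  rw [hsum] at hmain
  have e83 : (15 : ℝ) / (8 * (d : ℝ) ^ 3) - 3 / (8 * (d : ℝ) ^ 3) = 3 / (2 * (d : ℝ) ^ 3) := by
    field_simp
    ring
  linarith

/-- **`G_d ≤ 1 + 1/(2d) + 3/(4d²) + 3/(2d³) + 105/(16d⁴) + 102352/d⁵`** for `d ≥ 5`: nine-term Taylor enclosure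
(`R = 9` in `abs_srwI_sub_taylor_le_kernel`) with the exact `p₂(0)`, `p₄(0)` and the Gaussian bounds
`p₆(0) ≤ 15/(8d³)`, `p₈(0) ≤ 105/(16d⁴)`; remainder `2⁷√(19‼)/(2d)⁵ ≤ 102352/d⁵`. Sharper than the `R = 7` form
for `d ≥ 10`. [cite: HaraSladeSokal1993, Appendix A, eq. (A.17) (I₁,₀(0) = 1 + s + 3s² + 12s³ + 60s⁴ + …)] -/
theorem srwI_one_zero_zero_le_sharp₉ (hd : 5 ≤ d) :
    srwI d 1 0 0 ≤ 1 + 1 / (2 * (d : ℝ)) + 3 / (4 * (d : ℝ) ^ 2) + 3 / (2 * (d : ℝ) ^ 3) + 105 / (16 * (d : ℝ) ^ 4) +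
      102352 / (d : ℝ) ^ 5 := by
  have hd1 : 1 ≤ d := by omega
  have hd0 : (0 : ℝ) < d := by exact_mod_cast (show 0 < d by omega)
  have h := abs_srwI_sub_taylor_le_kernel (d := d) (n := 0) (l := 0) (R := 9) (by omega)
    (by decide) (0 : Fin d → ℤ)
  have hp0 : srwLaw d 0 (0 : Fin d → ℤ) = 1 := by rw [srwLaw_zero_apply, if_pos rfl]
  have hp1 : srwLaw d 1 (0 : Fin d → ℤ) = 0 := by simpa using srwLaw_odd_zero (d := d) 0
  have hp3 : srwLaw d 3 (0 : Fin d → ℤ) = 0 := by simpa using srwLaw_odd_zero (d := d) 1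
  have hp5 : srwLaw d 5 (0 : Fin d → ℤ) = 0 := by simpa using srwLaw_odd_zero (d := d) 2
  have hp7 : srwLaw d 7 (0 : Fin d → ℤ) = 0 := by simpa using srwLaw_odd_zero (d := d) 3
  have hp9 : srwLaw d 9 (0 : Fin d → ℤ) = 0 := by simpa using srwLaw_odd_zero (d := d) 4
  have hp2 : srwLaw d 2 (0 : Fin d → ℤ) = 1 / (2 * (d : ℝ)) := srwLaw_two_zero hd1
  have hp4 : srwLaw d 4 (0 : Fin d → ℤ) = 3 / (4 * (d : ℝ) ^ 2) - 3 / (8 * (d : ℝ) ^ 3) := srwLaw_four_zero hd1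
  have hp6 : srwLaw d 6 (0 : Fin d → ℤ) ≤ 15 / (8 * (d : ℝ) ^ 3) := by
    have := srwLaw_two_mul_zero_le hd1 3
    norm_num [Nat.doubleFactorial] at this
    have e : (2 * (d : ℝ)) ^ 3 = 8 * (d : ℝ) ^ 3 := by ring
    rw [e] at this
    exact this
  have hp8 : srwLaw d 8 (0 : Fin d → ℤ) ≤ 105 / (16 * (d : ℝ) ^ 4) := by
    have := srwLaw_two_mul_zero_le hd1 4
    norm_num [Nat.doubleFactorial] at this
    have e : (2 * (d : ℝ)) ^ 4 = 16 * (d : ℝ) ^ 4 := by ring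
    rw [e] at this
    exact this
  have hsum : ∑ i ∈ range (9 + 1), (((i + 0).choose 0 : ℕ) : ℝ) * srwLaw d (0 + i) 0 =
      1 + srwLaw d 2 0 + srwLaw d 4 0 + srwLaw d 6 0 + srwLaw d 8 0 := by
    simp only [Finset.sum_range_succ, Finset.sum_range_zero, Nat.add_zero, Nat.choose_zero_right, Nat.cast_one,
      one_mul, Nat.zero_add, hp0, hp1, hp3, hp5, hp7, hp9]
    ring
  have hrem : ∑ t ∈ range (0 + 1), (((9 + t).choose t : ℕ) : ℝ) *
      (Real.sqrt ((((2 * (0 + 9 + 1) - 1)‼ : ℕ) : ℝ) / (2 * (d : ℝ)) ^ (0 + 9 + 1)) *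
        (2 : ℝ) ^ (6 * (0 + 1 - t) + 1)) ≤ 102352 / (d : ℝ) ^ 5 := by
    have h19 : (((2 * (0 + 9 + 1) - 1)‼ : ℕ) : ℝ) = 654729075 := by norm_num [Nat.doubleFactorial]
    simp only [Finset.sum_range_succ, Finset.sum_range_zero, zero_add, Nat.add_zero, Nat.choose_zero_right,
      Nat.cast_one, one_mul, h19]
    norm_num
    have hs10 : Real.sqrt ((2 * (d : ℝ)) ^ 10) = (2 * (d : ℝ)) ^ 5 := by
      rw [show (2 * (d : ℝ)) ^ 10 = ((2 * (d : ℝ)) ^ 5) ^ 2 by ring, Real.sqrt_sq (by positivity)]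
    have hs1 : Real.sqrt 654729075 ≤ 25588 := by
      rw [show (25588 : ℝ) = Real.sqrt (25588 ^ 2) by rw [Real.sqrt_sq (by norm_num)]]
      exact Real.sqrt_le_sqrt (by norm_num)
    have hs0 : 0 ≤ Real.sqrt 654729075 := Real.sqrt_nonneg _
    rw [hs10, div_mul_eq_mul_div, div_le_div_iff₀ (by positivity) (by positivity)]
    have hd5 : (0 : ℝ) < (d : ℝ) ^ 5 := by positivity
    nlinarith [mul_le_mul_of_nonneg_right hs1 hd5.le]
  have hmain := (abs_sub_le_iff.1 h).1
  rw [hsum] at hmain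
  have e83 : (15 : ℝ) / (8 * (d : ℝ) ^ 3) - 3 / (8 * (d : ℝ) ^ 3) = 3 / (2 * (d : ℝ) ^ 3) := by
    field_simp
    ring
  linarith

/-! ### The renewal floor to second order: HSS93 (6.20) `s⁻¹ − 1 − s − 4s² − …` -/

/-- The renewal bound with the `R = 7` enclosure and the exact `p₄(0)`:
`2d / (2 − 1/(1 + 1/(2d) + 3/(4d²) + 3/(2d³) + 11392/d⁴)) ≤ μ(ℤ^d)` (`d ≥ 5`).
[cite: HaraSladeSokal1993, Section 2.3, eq. (2.32)-(2.33); Section 6.3, eq. (6.20)] -/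
theorem two_mul_div_renewal_sharp₇_le_connectiveConstant (hd : 5 ≤ d) :
    2 * (d : ℝ) / (2 - 1 / (1 + 1 / (2 * (d : ℝ)) + 3 / (4 * (d : ℝ) ^ 2) + 3 / (2 * (d : ℝ) ^ 3) +
      11392 / (d : ℝ) ^ 4)) ≤ connectiveConstant d :=
  two_mul_div_renewal_le_connectiveConstant_of_le (by omega) (srwI_one_zero_zero_le_sharp₇ hd)

/-- The renewal bound with the `R = 9` enclosure:
`2d / (2 − 1/(1 + 1/(2d) + 3/(4d²) + 3/(2d³) + 105/(16d⁴) + 102352/d⁵)) ≤ μ(ℤ^d)` (`d ≥ 5`).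
[cite: HaraSladeSokal1993, Section 2.3, eq. (2.32)-(2.33); Section 6.3, eq. (6.20)] -/
theorem two_mul_div_renewal_sharp₉_le_connectiveConstant (hd : 5 ≤ d) :
    2 * (d : ℝ) / (2 - 1 / (1 + 1 / (2 * (d : ℝ)) + 3 / (4 * (d : ℝ) ^ 2) + 3 / (2 * (d : ℝ) ^ 3) +
      105 / (16 * (d : ℝ) ^ 4) + 102352 / (d : ℝ) ^ 5)) ≤ connectiveConstant d :=
  two_mul_div_renewal_le_connectiveConstant_of_le (by omega) (srwI_one_zero_zero_le_sharp₉ hd)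

/-- **Second-order Kesten floor with the printed `s²` coefficient of HSS93 (6.20):
`2d − 1 − 1/(2d) − 1/d² − 22784/d³ ≤ μ(ℤ^d)` for every `d ≥ 5`** (`R = 7` form). In `s = 1/(2d)`:
`s⁻¹ − 1 − s − 4s² − O(s³) ≤ μ`, the expansion (6.20) of the `(0,1)` bound to order `s²` as a rigorous all-`d`
inequality; the previous tree value of the `d⁻²` coefficient was `7/4` (`kesten_second_order_effective_renewal`).
[cite: HaraSladeSokal1993, Section 6.3, eq. (6.20) (mu^(0,1) = s^-1 - 1 - s - 4s^2 - 22s^3 - 143s^4 + O(s^5))] -/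
theorem kesten_second_order_renewal_sharp₇ (hd : 5 ≤ d) :
    2 * (d : ℝ) - 1 - 1 / (2 * (d : ℝ)) - 1 / (d : ℝ) ^ 2 - 22784 / (d : ℝ) ^ 3 ≤ connectiveConstant d := by
  have hd5 : (5 : ℝ) ≤ d := by exact_mod_cast hd
  have hd0 : (0 : ℝ) < d := by linarith
  refine le_trans ?_ (two_mul_div_renewal_sharp₇_le_connectiveConstant hd)
  set B : ℝ := 1 + 1 / (2 * (d : ℝ)) + 3 / (4 * (d : ℝ) ^ 2) + 3 / (2 * (d : ℝ) ^ 3) + 11392 / (d : ℝ) ^ 4 with hB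
  have hB1 : 1 ≤ B := by
    rw [hB]
    have : (0 : ℝ) ≤ 1 / (2 * (d : ℝ)) + 3 / (4 * (d : ℝ) ^ 2) + 3 / (2 * (d : ℝ) ^ 3) + 11392 / (d : ℝ) ^ 4 := by
      positivity
    linarith
  have hB0 : 0 < B := by linarith
  have hW : (0 : ℝ) < 2 - 1 / B := by
    have : 1 / B ≤ 1 := by rw [div_le_one hB0]; exact hB1
    linarith
  rw [le_div_iff₀ hW, hB]
  have key : (2 * (d : ℝ) - 1 - 1 / (2 * (d : ℝ)) - 1 / (d : ℝ) ^ 2 - 22784 / (d : ℝ) ^ 3) *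
      (2 - 1 / (1 + 1 / (2 * (d : ℝ)) + 3 / (4 * (d : ℝ) ^ 2) + 3 / (2 * (d : ℝ) ^ 3) + 11392 / (d : ℝ) ^ 4)) =
      2 * d - (76 * (d : ℝ) ^ 4 + 729136 * (d : ℝ) ^ 3 + 729136 * (d : ℝ) ^ 2 + 1458176 * d + 8305770496) /
        (2 * (d : ℝ) ^ 3 * (8 * (d : ℝ) ^ 4 + 4 * (d : ℝ) ^ 3 + 6 * (d : ℝ) ^ 2 + 12 * d + 91136)) := by
    field_simp
    ring
  rw [key]
  have : (0 : ℝ) ≤ (76 * (d : ℝ) ^ 4 + 729136 * (d : ℝ) ^ 3 + 729136 * (d : ℝ) ^ 2 + 1458176 * d + 8305770496) /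
      (2 * (d : ℝ) ^ 3 * (8 * (d : ℝ) ^ 4 + 4 * (d : ℝ) ^ 3 + 6 * (d : ℝ) ^ 2 + 12 * d + 91136)) := by positivity
  linarith

/-- **`2d − 1 − 1/(2d) − 1/d² − 9/d³ − 204704/d⁴ ≤ μ(ℤ^d)` for every `d ≥ 5`** (`R = 9` form; the better closed
form for `d ≥ 10`: at `d = 100` it certifies `μ ≥ 198.99284`, the `R = 7` form `198.97213`, against
`μ(ℤ¹⁰⁰) = 198.99492…` from the `1/d` expansion). In `s = 1/(2d)`: `s⁻¹ − 1 − s − 4s² − 72s³ − O(s⁴) ≤ μ`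
(HSS93 (6.20): the exact `(0,1)` bound is `s⁻¹ − 1 − s − 4s² − 22s³ − …`; the truth is `−3s² − 16s³`, (6.18)).
[cite: HaraSladeSokal1993, Section 6.3, eq. (6.18) and eq. (6.20)] -/
theorem kesten_second_order_renewal_sharp₉ (hd : 5 ≤ d) :
    2 * (d : ℝ) - 1 - 1 / (2 * (d : ℝ)) - 1 / (d : ℝ) ^ 2 - 9 / (d : ℝ) ^ 3 - 204704 / (d : ℝ) ^ 4 ≤
      connectiveConstant d := by
  have hd5 : (5 : ℝ) ≤ d := by exact_mod_cast hd
  have hd0 : (0 : ℝ) < d := by linarith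
  refine le_trans ?_ (two_mul_div_renewal_sharp₉_le_connectiveConstant hd)
  set B : ℝ := 1 + 1 / (2 * (d : ℝ)) + 3 / (4 * (d : ℝ) ^ 2) + 3 / (2 * (d : ℝ) ^ 3) + 105 / (16 * (d : ℝ) ^ 4) +
    102352 / (d : ℝ) ^ 5 with hB
  have hB1 : 1 ≤ B := by
    rw [hB]
    have : (0 : ℝ) ≤ 1 / (2 * (d : ℝ)) + 3 / (4 * (d : ℝ) ^ 2) + 3 / (2 * (d : ℝ) ^ 3) + 105 / (16 * (d : ℝ) ^ 4) +
        102352 / (d : ℝ) ^ 5 := by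
      positivity
    linarith
  have hB0 : 0 < B := by linarith
  have hW : (0 : ℝ) < 2 - 1 / B := by
    have : 1 / B ≤ 1 := by rw [div_le_one hB0]; exact hB1
    linarith
  rw [le_div_iff₀ hW, hB]
  have key : (2 * (d : ℝ) - 1 - 1 / (2 * (d : ℝ)) - 1 / (d : ℝ) ^ 2 - 9 / (d : ℝ) ^ 3 - 204704 / (d : ℝ) ^ 4) *
      (2 - 1 / (1 + 1 / (2 * (d : ℝ)) + 3 / (4 * (d : ℝ) ^ 2) + 3 / (2 * (d : ℝ) ^ 3) + 105 / (16 * (d : ℝ) ^ 4) +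
        102352 / (d : ℝ) ^ 5)) =
      2 * d - (20 * (d : ℝ) ^ 6 + 804 * (d : ℝ) ^ 5 + 13101794 * (d : ℝ) ^ 4 + 13102340 * (d : ℝ) ^ 3 +
          26205892 * (d : ℝ) ^ 2 + 144930432 * d + 1340919283712) /
        (2 * (d : ℝ) ^ 4 * (16 * (d : ℝ) ^ 5 + 8 * (d : ℝ) ^ 4 + 12 * (d : ℝ) ^ 3 + 24 * (d : ℝ) ^ 2 + 105 * d +
          1637632)) := by
    field_simp
    ring
  rw [key]
  have : (0 : ℝ) ≤ (20 * (d : ℝ) ^ 6 + 804 * (d : ℝ) ^ 5 + 13101794 * (d : ℝ) ^ 4 + 13102340 * (d : ℝ) ^ 3 +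
          26205892 * (d : ℝ) ^ 2 + 144930432 * d + 1340919283712) /
        (2 * (d : ℝ) ^ 4 * (16 * (d : ℝ) ^ 5 + 8 * (d : ℝ) ^ 4 + 12 * (d : ℝ) ^ 3 + 24 * (d : ℝ) ^ 2 + 105 * d +
          1637632)) := by positivity
  linarith

end Literature.Probability.RandomPlanarGeometry.SAW.Zd.LoopErasure

end
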